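import Summits.NavierStokesRegularity.NavierStokesRegularity.Theorems.PeepholeVorticityDoorDefs
import Literature.Analysis.FluidPDE.PineauVicolSmallVorticityPropagation

/-!
# PeepholeVorticityDoorAssemblyInt — door S29 «PeepholeVorticityDoor», FILE 3′ of the LINE DOC: the Pineau–Vicol assembly into
# the INTEGRAL-pressure PV-frame door, `PeepholeToCore → PVPeepholeRegularityInt` (integral form of stub 2 of nsreg-p1 g23 `r27/Sketch29.lean` 18df910412472115; landing by nsreg-p6 g15,
# DIRECTOR-NS #106 (1)(b))

The bookkeeping twin of the tree's `Literature.Analysis.FluidPDE.pineauVicol2026_oneSlice_regularity_of_core'`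
(Pineau–Vicol 2026, proof of Theorem 1.9, arXiv:2607.09619 §9 p. 31–35) with the §9.3 input `hB` (one-slice smallness of
the core enstrophy from the residual hypothesis (1.17)) replaced by the PEEPHOLE-TO-CORE transfer `PeepholeToCore` (hB′):
peephole-small scale-normalised vorticity at `t̄` ⇒ small core enstrophy at SOME earlier `t' ∈ [(1+2τ)t̄, (1+τ)t̄]`,
and with the annular sup bound (1.16) replaced by the INTEGRAL pressure hypotheses of `PVPeepholeRegularityInt` (a bound
`B_p` for `∫∫_{(−1,0)×B₁}|p|^{3/2}` and `∫∫_{(−1,0)×B₁}|∇u|² < ∞` — exactly what p. 33–35 consume downstream of (1.16), so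
that Prop. 9.5 is invoked in its class form `pineauVicol_regular_of_zoom` rather than `…_of_zoom_small`).
Everything else is the printed p. 33–35 assembly with the tree's PROVED ingredients: Lemma 9.4
(`pineauVicol_smallVorticity_propagation`) applied at `t'`, Lemma 9.2 / Cor. 9.3
(`exists_forall_fderiv_le_of_typeI_of_bounds`, `exists_forall_iteratedFDeriv_le_of_typeI_of_bounds 2`, constants bumped to
`K + 1`, `K₂ + 1 > 0`), the bounds `B_u(C_u)`, `B_p(C_u, C_p)` (`lintegral_typeI_cube_le`; `B_p` is now a hypothesis), (9.15)–(9.16) (`exists_cknE_le_of_core_small`) and Prop. 9.5 + CKN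
(`pineauVicol_regular_of_zoom`, fed the zoomed classes `∇u_c ∈ L²(Q₁)` — `lintegral_parabolicCylinder_one_fderiv_nsRescale` —
and `p_c ∈ L^{3/2}(Q₁)` — `MemLp.smul_uncurry_stPull`).  Quantifier order of the door: `θ, R, K, K₂` and the peephole `ε` are fixed from
`C_u, y₀, r` BEFORE `B_p`; `c₁, T₀, T₁` and the lateness `s₀ = max 1 (1 − log T⋆)`, `T⋆ = min T₀ T₁ / (1 + 2τ)`, after.
-/

noncomputable section

set_option linter.dupNamespace false

namespace Summit.NavierStokesRegularity.NavierStokesRegularity.Theorems.PeepholeVorticityDoor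

open MeasureTheory Set Function Filter Metric TopologicalSpace
open scoped ENNReal NNReal Topology
open Literature.Analysis Literature.Analysis.FluidPDE

-- nested operator types
set_option maxSynthPendingDepth 3

/-- the backward parabolic cylinder `Q_a(0,0) = (−a², 0) × B_a` lies in `(−1, 0) × B_a` for `0 < a ≤ 1`. -/
theorem parabolicCylinder_origin_subset {a : ℝ} (ha : 0 < a) (ha1 : a ≤ 1) :
    parabolicCylinder a (0 : ℝ × EuclideanSpace ℝ (Fin 3)) ⊆
      Ioo (-1 : ℝ) 0 ×ˢ ball (0 : EuclideanSpace ℝ (Fin 3)) a := fun w hw => by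
  rw [mem_parabolicCylinder] at hw
  have h1 : a ^ 2 ≤ 1 := pow_le_one₀ ha.le ha1
  have h2 : (0 : ℝ × EuclideanSpace ℝ (Fin 3)).1 - a ^ 2 < w.1 := hw.1.1
  have h3 : w.1 < (0 : ℝ × EuclideanSpace ℝ (Fin 3)).1 := hw.1.2
  simp only [Prod.fst_zero] at h2 h3
  refine mk_mem_prod ⟨by linarith, h3⟩ ?_
  simpa using hw.2

/-- **S29 stub 2, integral form (assembly): `PeepholeToCore → PVPeepholeRegularityInt`.**  Given the peephole-to-core
transfer hB′, the integral-pressure PV-frame door follows exactly as Theorem 1.9 follows from §9.3 (tree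
`pineauVicol2026_oneSlice_regularity_of_core'`, with `B_p` a hypothesis instead of a consequence of (1.16)):
universal `ε_CKN` (`pineauVicol_regular_of_zoom_small`), `θ = min(ϑ, √(ε_CKN/20))`, `K = K(C_u) + 1`, `K₂ = K₂(C_u) + 1`,
`R = max(R₀, 4J K²/θ²)`, the peephole constant `ε = min(ε_{hB′}, 1)` and delay `τ` from hB′; then for `B_p` the scale `c₁`,
Lemma 9.4's `T₀`, hB′'s `T₁`, `T⋆ = min T₀ T₁/(1+2τ)` and `s₀ = max 1 (1 − log T⋆)`; for a solution and `t̄ ∈ (−e^{−s₀}, 0)`: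
hB′ gives `t' ∈ [(1+2τ)t̄, (1+τ)t̄] ⊆ (−T₀, 0)` with `∫_{B(2R√(−t'))}‖ω(t')‖² ≤ θ²/(4√(−t'))`, Lemma 9.4 the small core
dissipation on `[t', 0)`, (9.15)–(9.16) `E(r; u) ≤ 10θ² < ε_CKN` for `r ≤ min(√(−t'), c₁/2, 1/32)`, and Prop. 9.5 concludes. -/
theorem pvPeepholeRegularityInt_of_peepholeToCore (hB : PeepholeToCore) : PVPeepholeRegularityInt := by
  intro Cu hCu y₀ r hr
  -- universal constants
  obtain ⟨ε, hε, Hzoom⟩ := pineauVicol_regular_of_zoom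
  obtain ⟨J, hJ, Hglue⟩ := exists_cknE_le_of_core_small
  obtain ⟨K', hK'0, HK⟩ := exists_forall_fderiv_le_of_typeI_of_bounds Cu
  obtain ⟨K₂', hK₂'0, HK₂⟩ := exists_forall_iteratedFDeriv_le_of_typeI_of_bounds 2 Cu
  obtain ⟨ϑ, hϑ, HA⟩ := pineauVicol_smallVorticity_propagation
  set K : ℝ := K' + 1 with hK_def
  set K₂ : ℝ := K₂' + 1 with hK₂_def
  have hK0 : 0 < K := by positivity
  have hK₂0 : 0 < K₂ := by positivity
  -- `θ` with `10 θ² < ε`, `θ ≤ ϑ`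
  set θ : ℝ := min ϑ (Real.sqrt (ε / 20)) with hθ_def
  have hθ0 : 0 < θ := lt_min hϑ (Real.sqrt_pos.2 (by positivity))
  have hθϑ : θ ≤ ϑ := min_le_left _ _
  have hθε : 10 * θ ^ 2 < ε := by
    have h1 : θ ≤ Real.sqrt (ε / 20) := min_le_right _ _
    have h2 : θ ^ 2 ≤ ε / 20 := by
      calc θ ^ 2 ≤ (Real.sqrt (ε / 20)) ^ 2 := pow_le_pow_left₀ hθ0.le h1 2
        _ = ε / 20 := Real.sq_sqrt (by positivity)
    linarith
  obtain ⟨R₀, hR₀2, HA'⟩ := HA θ hθ0 hθϑ Cu K K₂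
  -- `R` with `J K² / (R/2) ≤ θ²`
  set R : ℝ := max R₀ (4 * J * K ^ 2 / θ ^ 2) with hR_def
  have hRR₀ : R₀ ≤ R := le_max_left _ _
  have hR2 : 2 ≤ R := hR₀2.trans hRR₀
  have hR0 : 0 < R := by linarith
  have hJR : J * K ^ 2 / (R / 2) ≤ θ ^ 2 := by
    have h1 : 4 * J * K ^ 2 / θ ^ 2 ≤ R := le_max_right _ _
    rw [div_le_iff₀ (by positivity)]
    rw [div_le_iff₀ (by positivity)] at h1
    nlinarith
  -- hB′: the peephole constant `ε₁` and the delay `τ`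
  obtain ⟨ε₁, hε₁, τ, hτ, HB⟩ := hB Cu hCu θ hθ0 R hR2 K K₂ hK0 hK₂0 y₀ r hr
  refine ⟨min ε₁ 1, lt_min hε₁ one_pos, min_le_right _ _, fun Bp => ?_⟩
  -- the global bound `Bu(Cu)` and the scale `c₁`
  set Tq : ℝ≥0∞ := ∫⁻ t in Ioo (-1 : ℝ) 0, ENNReal.ofReal ((-t) ^ (-(1 / 4 : ℝ))) with hTq
  set Xq : ℝ≥0∞ := ∫⁻ x in ball (0 : EuclideanSpace ℝ (Fin 3)) 1,
    ENNReal.ofReal (‖x‖ ^ (-(5 / 2 : ℝ))) with hXq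
  set Bu : ℝ≥0∞ := ENNReal.ofReal (Cu ^ 3) * (Tq * Xq) with hBu
  have hBut : Bu < ⊤ := ENNReal.mul_lt_top ENNReal.ofReal_lt_top
    (ENNReal.mul_lt_top lintegral_Ioo_neg_rpow_quarter_lt_top lintegral_ball_norm_rpow_lt_top)
  obtain ⟨c₁', hc₁', Hgrad'⟩ := HK Bu Bp hBut ENNReal.coe_lt_top
  obtain ⟨c₂, hc₂, Hgrad2⟩ := HK₂ Bu Bp hBut ENNReal.coe_lt_top
  set c₁ : ℝ := min c₁' c₂ with hc₁_def
  have hc₁ : 0 < c₁ := lt_min hc₁' hc₂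
  obtain ⟨T₀, hT₀, hT₀1, HA''⟩ := HA' R hRR₀ c₁ hc₁
  obtain ⟨T₁, hT₁, hT₁1, HB'⟩ := HB c₁ hc₁
  -- the lateness `T⋆ = min T₀ T₁ / (1 + 2τ)`, `s₀ = max 1 (1 − log T⋆)`
  set Ts : ℝ := min T₀ T₁ / (1 + 2 * τ) with hTs_def
  have hmin0 : 0 < min T₀ T₁ := lt_min hT₀ hT₁
  have hTs : 0 < Ts := by positivity
  have hTsle : Ts ≤ min T₀ T₁ := by
    rw [hTs_def, div_le_iff₀ (by positivity)]
    nlinarith [hτ, hmin0]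
  have hTs1 : Ts ≤ T₁ := hTsle.trans (min_le_right _ _)
  have hTsT₀ : (1 + 2 * τ) * Ts ≤ T₀ := by
    rw [hTs_def, mul_div_cancel₀ _ (by positivity : (1 + 2 * τ) ≠ 0)]
    exact min_le_left _ _
  set s₀ : ℝ := max 1 (1 - Real.log Ts) with hs₀_def
  have hs₀1 : 1 ≤ s₀ := le_max_left _ _
  have hexp : Real.exp (-s₀) ≤ Ts := by
    have h1 : -s₀ ≤ Real.log Ts - 1 := by
      have := le_max_right 1 (1 - Real.log Ts)
      linarith
    calc Real.exp (-s₀) ≤ Real.exp (Real.log Ts - 1) := Real.exp_le_exp.2 h1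
      _ ≤ Real.exp (Real.log Ts) := Real.exp_le_exp.2 (by linarith)
      _ = Ts := Real.exp_log hTs
  refine ⟨s₀, hs₀1, fun u p hreg hI hP hG tb htb1 htb0 hsl => ?_⟩
  have htbT : -Ts < tb := by linarith
  have htbT₁ : -T₁ < tb := by linarith
  -- the bounds of this solution
  have hBu_u : ∫⁻ w in Ioo (-1 : ℝ) 0 ×ˢ ball (0 : EuclideanSpace ℝ (Fin 3)) 1,
      ‖u w.1 w.2‖ₑ ^ (3 : ℕ) ≤ Bu := by
    refine le_trans (le_of_eq (lintegral_congr fun w => ?_)) (lintegral_typeI_cube_le hI)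
    rw [← ofReal_norm, ENNReal.ofReal_pow (norm_nonneg _)]
  have hP32 : ∫⁻ w in Ioo (-1 : ℝ) 0 ×ˢ ball (0 : EuclideanSpace ℝ (Fin 3)) (1 / 32),
      ‖p w.1 w.2‖ₑ ^ (3 / 2 : ℝ) ≤ (Bp : ℝ≥0∞) :=
    (lintegral_mono_set (prod_mono Subset.rfl (ball_subset_ball (by norm_num)))).trans hP
  have hgradu : ∀ t ∈ Ioo (-1 : ℝ) 0, ∀ x : EuclideanSpace ℝ (Fin 3), ‖x‖ + Real.sqrt (-t) ≤ c₁ →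
      ‖fderiv ℝ (u t) x‖ ≤ K / (‖x‖ + Real.sqrt (-t)) ^ 2 := fun t ht x hx => by
    have hpos : 0 < ‖x‖ + Real.sqrt (-t) :=
      add_pos_of_nonneg_of_pos (norm_nonneg _) (Real.sqrt_pos.2 (by linarith [ht.2]))
    calc ‖fderiv ℝ (u t) x‖ ≤ K' / (‖x‖ + Real.sqrt (-t)) ^ 2 :=
          Hgrad' u p hreg hI hBu_u hP32 t ht x (hx.trans (min_le_left _ _))
      _ ≤ K / (‖x‖ + Real.sqrt (-t)) ^ 2 :=
          div_le_div_of_nonneg_right (by rw [hK_def]; linarith) (by positivity)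
  have hgrad2u : ∀ t ∈ Ioo (-1 : ℝ) 0, ∀ x : EuclideanSpace ℝ (Fin 3), ‖x‖ + Real.sqrt (-t) ≤ c₁ →
      ‖iteratedFDeriv ℝ 2 (u t) x‖ ≤ K₂ / (‖x‖ + Real.sqrt (-t)) ^ 3 := fun t ht x hx => by
    have hpos : 0 < ‖x‖ + Real.sqrt (-t) :=
      add_pos_of_nonneg_of_pos (norm_nonneg _) (Real.sqrt_pos.2 (by linarith [ht.2]))
    calc ‖iteratedFDeriv ℝ 2 (u t) x‖ ≤ K₂' / (‖x‖ + Real.sqrt (-t)) ^ 3 :=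
          Hgrad2 u p hreg hI hBu_u hP32 t ht x (hx.trans (min_le_right _ _))
      _ ≤ K₂ / (‖x‖ + Real.sqrt (-t)) ^ 3 :=
          div_le_div_of_nonneg_right (by rw [hK₂_def]; linarith) (by positivity)
  -- hB′: peephole-small at `t̄` ⇒ small core enstrophy at some `t' ∈ [(1+2τ)t̄, (1+τ)t̄]`
  have hsl' : ∀ x ∈ ball (Real.sqrt (-tb) • y₀) (Real.sqrt (-tb) * r), (-tb) * ‖curl (u tb) x‖ ≤ ε₁ :=
    fun x hx => (hsl x hx).trans (min_le_left _ _)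
  obtain ⟨t', ht', hcurl⟩ := HB' u p hreg hI hgradu hgrad2u tb ⟨htbT₁, htb0⟩ hsl'
  have ht'0 : t' < 0 := by
    have h1 : t' ≤ (1 + τ) * tb := ht'.2
    nlinarith
  have ht'T : -T₀ < t' := by
    have h1 : (1 + 2 * τ) * tb ≤ t' := ht'.1
    have h2 : (1 + 2 * τ) * (-Ts) < (1 + 2 * τ) * tb := mul_lt_mul_of_pos_left htbT (by positivity)
    linarith
  have ht'm1 : -1 < t' := by linarith
  have hsq : 0 < Real.sqrt (-t') := Real.sqrt_pos.2 (by linarith)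
  -- Lemma 9.4 at `t'`: the small core
  have hcore := HA'' u p hreg hI hgradu hgrad2u t' ⟨ht'T, ht'0⟩ hcurl
  -- (9.15)–(9.16): `E(r; u) ≤ 10 θ²` for `r ≤ r₀`
  have hO : IsOpen (Ioo (-1 : ℝ) 0 ×ˢ ball (0 : EuclideanSpace ℝ (Fin 3)) 1) :=
    isOpen_Ioo.prod isOpen_ball
  have hreg' := hreg.mono_of_isOpen (prod_mono Ioo_subset_Ico_self Subset.rfl) hO
  have hcont : ContinuousOn (fun w : ℝ × EuclideanSpace ℝ (Fin 3) => fderiv ℝ (u w.1) w.2)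
      (Ioo (-1 : ℝ) 0 ×ˢ ball (0 : EuclideanSpace ℝ (Fin 3)) 1) :=
    continuousOn_fderiv_slice_of_isOpen hO hreg'.smooth_velocity (by exact_mod_cast le_top)
  have hcore' : ∀ t ∈ Ioo (-(-t')) 0,
      ∫⁻ x in ball (0 : EuclideanSpace ℝ (Fin 3)) (R / 2 * Real.sqrt (-t)),
          ENNReal.ofReal (frobeniusNormSq (fderiv ℝ (u t) x)) ≤
        ENNReal.ofReal (4 * θ ^ 2 / Real.sqrt (-t)) := by
    intro t ht
    exact hcore t ⟨by linarith [ht.1], ht.2⟩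
  have hE : ∀ ρ : ℝ, 0 < ρ → ρ ≤ Real.sqrt (-t') → ρ ≤ c₁ / 2 → ρ ≤ 1 →
      cknE ρ (0 : ℝ × EuclideanSpace ℝ (Fin 3)) (fun t x => fderiv ℝ (u t) x) ≤
        ENNReal.ofReal (10 * θ ^ 2) :=
    Hglue u θ K c₁ (R / 2) (-t') hθ0 hK0.le hc₁ (by positivity) (by linarith) hcont hcore' hgradu hJR
  -- the zoom factor
  set c : ℝ := min (min (Real.sqrt (-t')) (c₁ / 2)) (1 / 32) with hc_def
  have hc0 : 0 < c := lt_min (lt_min hsq (by positivity)) (by norm_num)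
  have hc32 : c ≤ 1 / 32 := min_le_right _ _
  have hcsq : c ≤ Real.sqrt (-t') := (min_le_left _ _).trans (min_le_left _ _)
  have hcc₁ : c ≤ c₁ / 2 := (min_le_left _ _).trans (min_le_right _ _)
  have hsup : (⨆ ρ ∈ Ioo (0 : ℝ) 1,
      cknE ρ (0 : ℝ × EuclideanSpace ℝ (Fin 3)) (fun t x => fderiv ℝ (nsRescale c u t) x)) <
        ENNReal.ofReal ε := by
    refine lt_of_le_of_lt (iSup₂_le fun ρ hρ => ?_) ((ENNReal.ofReal_lt_ofReal_iff hε).2 hθε)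
    have h3 : stAffine (c ^ 2) c 0 (0 : EuclideanSpace ℝ (Fin 3)) (0 : ℝ × EuclideanSpace ℝ (Fin 3)) = 0 := by
      simp [stAffine]
    rw [fderiv_nsRescale_eq_smul_stPull, cknE_nsZoom hc0 hρ.1 0 0 0, h3]
    refine hE (c * ρ) (mul_pos hc0 hρ.1) ?_ ?_ ?_
    · calc c * ρ ≤ c * 1 := by gcongr; exact hρ.2.le
        _ ≤ Real.sqrt (-t') := by rw [mul_one]; exact hcsq
    · calc c * ρ ≤ c * 1 := by gcongr; exact hρ.2.le
        _ ≤ c₁ / 2 := by rw [mul_one]; exact hcc₁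
    · calc c * ρ ≤ c * 1 := by gcongr; exact hρ.2.le
        _ ≤ 1 := by rw [mul_one]; linarith
  -- the classes of Prop. 9.5 for the zoom `u_c`: `∇u_c ∈ L²(Q₁)`, `p_c ∈ L^{3/2}(Q₁)`
  have hc1 : c ≤ 1 := hc32.trans (by norm_num)
  have hGc : ∫⁻ w in parabolicCylinder 1 (0 : ℝ × EuclideanSpace ℝ (Fin 3)),
      ENNReal.ofReal (frobeniusNormSq (fderiv ℝ (nsRescale c u w.1) w.2)) < ⊤ := by
    rw [lintegral_parabolicCylinder_one_fderiv_nsRescale hc0]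
    refine ENNReal.mul_lt_top (ENNReal.inv_lt_top.2 (by simpa using hc0)) ?_
    exact lt_of_le_of_lt (lintegral_mono_set ((parabolicCylinder_origin_subset hc0 hc1).trans (prod_mono Subset.rfl (ball_subset_ball hc1)))) hG
  have hqc : MemLp (uncurry (nsRescalePressure c p)) (3 / 2)
      (volume.restrict (parabolicCylinder 1 (0 : ℝ × EuclideanSpace ℝ (Fin 3)))) := by
    set Q : Opens (ℝ × EuclideanSpace ℝ (Fin 3)) :=
      ⟨Ioo (-1 : ℝ) 0 ×ˢ ball (0 : EuclideanSpace ℝ (Fin 3)) 1, isOpen_Ioo.prod isOpen_ball⟩ with hQ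
    have hf : MemLp (uncurry p) (3 / 2) (volume.restrict (Q : Set (ℝ × EuclideanSpace ℝ (Fin 3)))) := by
      refine ⟨?_, ?_⟩
      · have hcont : ContinuousOn (uncurry p) (Ioo (-1 : ℝ) 0 ×ˢ ball (0 : EuclideanSpace ℝ (Fin 3)) 1) :=
          hreg.smooth_pressure.continuousOn.mono (prod_mono Ioo_subset_Ico_self Subset.rfl)
        exact hcont.aestronglyMeasurable (measurableSet_Ioo.prod measurableSet_ball)
      · rw [eLpNorm_lt_top_iff_lintegral_rpow_enorm_lt_top (by norm_num)
          (ENNReal.div_ne_top (by norm_num) (by norm_num))]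
        have h32 : ((3 / 2 : ℝ≥0∞)).toReal = (3 / 2 : ℝ) := by norm_num
        rw [h32]
        exact lt_of_le_of_lt hP ENNReal.coe_lt_top
    have h2 := hf.smul_uncurry_stPull (β := c ^ 2) (γ := c) (by positivity) hc0 0
      (0 : EuclideanSpace ℝ (Fin 3)) (c ^ 2)
    have ep : (c ^ 2) • stPull (c ^ 2) c 0 (0 : EuclideanSpace ℝ (Fin 3)) p = nsRescalePressure c p := by
      funext s y
      simp [stPull_apply, nsRescalePressure_apply]
    rw [ep] at h2
    refine h2.mono_measure (Measure.restrict_mono_set _ fun z hz => ?_)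
    rw [coe_stPreimage, mem_preimage]
    obtain ⟨hs, hy⟩ := sq_mul_mem_Ioo_and_smul_mem_ball hc0 hc1 (s := z.1) (y := z.2) hz
    change (0 + c ^ 2 * z.1, (0 : EuclideanSpace ℝ (Fin 3)) + c • z.2) ∈
      Ioo (-1 : ℝ) 0 ×ˢ ball (0 : EuclideanSpace ℝ (Fin 3)) 1
    rw [zero_add, zero_add]
    exact mk_mem_prod hs hy
  exact Hzoom u p Cu c hreg hI hc0 (by linarith) hGc hqc hsup

/-- **COMPOSITION after FILE 3′:** door S29 from the explicit transfer (FILE 2) and the integral-form frame transfer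
(FILE 4) alone. -/
theorem targetPeepholeVorticity_of_int' (h₁ : PeepholeToCoreExplicit)
    (h₃ : PVPeepholeRegularityInt → TargetPeepholeVorticity) : TargetPeepholeVorticity :=
  targetPeepholeVorticity_of_int h₁ pvPeepholeRegularityInt_of_peepholeToCore h₃

end Summit.NavierStokesRegularity.NavierStokesRegularity.Theorems.PeepholeVorticityDoor

end
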